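import Literature.AlgebraicGeometry.ComplexMultiplication.MumfordTateTorusAbelianVarietyKubotaRank
import Literature.Geometry.Kaehler.ComplexTorusCMLefschetzGroupConnected
import Literature.Geometry.Kaehler.ComplexTorusLefschetzGroupIsogenyFactorsIdentityComponent
import HarnessLib

/-!
# Abelian varieties of CM-type, structure-free (VI): MILNE'S TABLE «IV ∣ GL ∣ Connected: Yes» FOR EVERY ABELIAN
# VARIETY WHOSE MUMFORD–TATE GROUP IS A TORUS — `S(A)(ℂ)` is connected, `Lf(A) = S(A)`, and `S(A)(ℂ) ≅ (ℂ^×)^{rdim A}`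
# is a torus with `2 rdim A = [C(End⁰A):ℚ]` («`K` is a CM-field, and `S(A)` is a torus»)

Topic `Literature/AlgebraicGeometry/ComplexMultiplication`, namespace `Literature.Geometry.Kaehler.ComplexTorus.IsAbelianVariety`;
lane `lit-hodgefound` (Track 2 foundations library), Layer A3/A4 junction, seat p19 generation 30, self-proposed row g30-#2.
ASSEMBLY, BY NAME, of three landed pieces: (1) this seat's g28 model `MumfordTateTorusAbelianVarietyStructure`
(`IsAbelianVariety.exists_simple_cm_factors_of_isTorusSubgroup_mumfordTateGroupC`: `MT(A)(ℂ)` a torus ⟹ `A ∼ ∏ⱼ Bⱼ^{mⱼ}`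
with SIMPLE pairwise non-isogenous CM factors `Bⱼ = ℂ^{Φⱼ}/u(𝔪ⱼ)`, `End⁰(Bⱼ) ≅ Kⱼ` a CM field, `[C(End⁰A):ℚ] = Σⱼ [Kⱼ:ℚ]`);
(2) skel-4's ROW A4-92 `Geometry/Kaehler/ComplexTorusCMLefschetzGroupConnected` (Milne §2 type IV with `E = K`:
`IsIsogenous.lefschetzIdentityC_eq_lefschetzGroupC_of_powers_of_endAlgRat_comm`,
`exists_mulEquiv_lefschetzGroupC_pi_units_of_endAlgRat_comm` — `S(B)(ℂ) ≅ (ℂ^×)^{dim B}` for `End_ℚ(B)` commutative of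
dimension `2 dim B`); (3) p36's `Geometry/Kaehler/ComplexTorusLefschetzGroupIsogenyFactorsIdentityComponent` (Milne's
Prop. 1.5 on complex points, `IsIsogenous.nonempty_lefschetzGroupC_mulEquiv_pi_of_powers : S(X)(ℂ) ≃ ∏ₖ S(B_k)(ℂ)`,
`homRat_eq_bot_of_isSimple_of_not_isIsogenous`).  THEOREMS ONLY: no definition, no instance, no named fact (D-0026, net
Literature debt `0`), no `sorry`; sequel of g29-#4 `MumfordTateTorusAbelianVarietyLefschetzRank` (the same statements for
the `ℚ`-LIE ALGEBRA `Lie S(A)`: `2 dim_ℚ Lie S(A) = [C(End⁰A):ℚ]`), now for the GROUP `S(A)(ℂ)`.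

## Sources, VERBATIM

* J. S. Milne, *Lefschetz classes on abelian varieties*, Duke Math. J. 96 (1999) [Milne1999LefschetzClasses], held
  text `paper:milne1999-lefschetz-classes-abelian-varieties`: §1 p. 644 (p0006) PROPOSITION 1.5 «Any such isogeny
  `A₁^{r₁} × ⋯ × A_s^{r_s} → A` induces an isomorphism `S(A₁) × ⋯ × S(A_s) → S(A)`»; §2 p. 652 (p0014 L5–L63)
  «Summary. The following table summarizes the properties of the reductive groups `S(A)`. Type ∣ Group ∣ Semisimple ∣
  Connected … IV ∣ GL ∣ No ∣ Yes … The group `S(A)_{/k^{al}}` is isomorphic to `f` copies of the group listed in the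
  second column»; §2 p. 651 (p0013 L40–L47) «`S(A)_{/k^al} = ∏ S_σ` where `S_σ ≈ Aut_{M_d(k^al)}(V₁) ≈ GL_{g/(fd)}(k^al)`»;
  §3 p. 661 (p0023 L19–L22) «If `A` is not a supersingular elliptic curve, then `K` is a CM-field, and `S(A)` is a
  torus. Every embedding `σ : K → k^al` defines a character of `S(A)`, and the character group of `S(A)` is the quotient
  of `ℤ^{Hom(K,k^al)}` by the subgroup generated by the elements `σ + ισ`.»
* P. Deligne (notes by J. Milne), *Hodge cycles on abelian varieties*, LNM 900 (1982) [Deligne1982HodgeCycles], I §5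
  Prop. 5.1, p. 53: an abelian variety is of CM-type iff its Mumford–Tate group is commutative (a torus).
* B. B. Gordon, *A survey of the Hodge conjecture for abelian varieties* (1999) [Gordon1999HodgeAVSurvey], 7.4
  (`rdim A = Σᵢ rdim Aᵢ`, `rdim Aᵢ = (dim Aᵢ)/d` … «in general `rank Hg(A) ≤ rdim A`»), 7.7 («for type (IV), a unitary
  group … after complexifying … the sum of a standard representation of the complex general linear group and its
  contragredient»), 2.15 Lemma.
* H. Lange, *Abelian Varieties over the Complex Numbers* (2023) [Lange2023AbelianVarietiesComplex], §7.2.4 Exercise (4)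
  (`Lf(X)` := the identity component of the centraliser of `End_ℚ(X)` in `Sp`; (c) `Lf(X) ≃ ∏ Lf(Xᵢ)`).

## What is formalised (`A = E/P(ℤ^ι)` an ABELIAN VARIETY, `dim A > 0`, whose Mumford–Tate group `MT(A)(ℂ)` is a
## torus (`IsTorusSubgroup (mumfordTateGroupC P)`, equivalently `Hg(A)(ℂ)` a torus); `η` ANY polarisation with
## rational Gram matrix `G`; `S(A)(ℂ) = lefschetzGroupC P G`, `Lf(A)(ℂ) = lefschetzIdentityC P G` (p17))

* §1 **«Connected: Yes»** — **`lefschetzIdentityC_eq_lefschetzGroupC_of_isTorusSubgroup_mumfordTateGroupC`**: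
  `Lf(A)(ℂ) = S(A)(ℂ)`, i.e. `S(A)(ℂ)⁰ = S(A)(ℂ)`; `isPrime_vanishingIdealC_lefschetzGroupC_…` (the vanishing ideal of
  `S(A)(ℂ)` is prime: irreducible); real points `lefschetzIdentity_eq_lefschetzGroup_…` (`Lf(A)(ℝ) = S(A)(ℝ)`, Lange's
  `Lf` is the whole real Lefschetz group `lefschetzGroup P η`); `Hg(A)(ℂ) ⊆ Lf(A)(ℂ)` is p17's
  `IsRiemannForm.hodgeGroupC_le_lefschetzIdentityC`.  Proof: the g28
  model's factors `Bⱼ` are simple, pairwise non-isogenous, polarised abelian varieties with `End_ℚ(Bⱼ) ≅ Kⱼ` commutative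
  of dimension `[Kⱼ:ℚ] = 2 dim Bⱼ`, so A4-92 §D applies to `A ∼ ∏ⱼ Bⱼ^{mⱼ}`.
* §2 **«`S(A)` is a torus», of dimension `rdim A`** — **`exists_mulEquiv_lefschetzGroupC_pi_units_of_isTorusSubgroup_mumfordTateGroupC`**:
  `S(A)(ℂ) ≃* (R → ℂ^×)` for a finite `R` with `2·#R = [C(End⁰A):ℚ]` (Prop. 1.5 `S(A)(ℂ) ≅ ∏ⱼ S(Bⱼ)(ℂ)`, then
  `S(Bⱼ)(ℂ) ≅ (ℂ^×)^{dim Bⱼ}` — «`f` copies of `GL_{g/(fd)}`» with `d = 1`, `g = f` — and `Σⱼ dim Bⱼ = Σⱼ [Kⱼ:ℚ]/2`);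
  consequences `lefschetzGroupC_comm_…` (`S(A)(ℂ)` is commutative), `…_card_le_…` (`2·#R ≤ 2 dim A`: `rdim A ≤ dim A`),
  `…_of_isSimple_…` (`A` simple: `#R = dim A`).
* §3 `Hg` twins of §1–§2 (`IsTorusSubgroup ((hodgeGroupC P).map toGL)`, Gordon's Prop. 2.12 wording).

NOT here: «`Hg(A) = Lf(A)` iff `rank MT(A) = rdim A + 1`» as an equality of GROUPS (the bridge from the group
`hodgeGroupC` to the Tannakian `mtRank` is not in the tree; the Lie-algebra rank form is g29-#4); types I–III.

## References

* [Milne1999LefschetzClasses] J. S. Milne, *Lefschetz classes on abelian varieties*, Duke Math. J. 96 (1999) 639–675,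
  §1 Prop. 1.5 (p. 644), §2 pp. 650–652 (type IV and the Summary table), §3 p. 661.
* [Deligne1982HodgeCycles] P. Deligne, *Hodge cycles on abelian varieties*, in LNM 900 (1982), I §5 Prop. 5.1 (p. 53).
* [Gordon1999HodgeAVSurvey] B. B. Gordon, *A survey of the Hodge conjecture for abelian varieties*, App. B of
  J. D. Lewis, *A survey of the Hodge conjecture*, 2nd ed. (1999), 2.15, 7.4, 7.7.
* [Lange2023AbelianVarietiesComplex] H. Lange, *Abelian Varieties over the Complex Numbers*, Springer 2023, §7.2.4
  Exercise (4), §2.4.1 Lemma 2.4.1, §5.3.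
-/

noncomputable section

open scoped Classical
open NumberField Module

namespace Literature.Geometry.Kaehler.ComplexTorus

open Literature.AlgebraicGeometry.Motives (CMType)
open Literature.AlgebraicGeometry.ComplexMultiplication (CMTorus.periodEquiv)
open Literature.AlgebraicGeometry.ComplexMultiplication.CMTorus
open Literature.NumberTheory.ComplexMultiplication (IsPrimitive)
open Literature.NumberTheory.Automorphic (IsTorusSubgroup)

variable {ι : Type} [Fintype ι] [DecidableEq ι] {E : Type} [NormedAddCommGroup E] [NormedSpace ℂ E]
  {P : (ι → ℝ) ≃L[ℝ] E} {η : E [⋀^Fin 2]→L[ℝ] ℝ} {G : Matrix ι ι ℚ}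

namespace IsAbelianVariety

/-! ## §0 The g28 model, trimmed to what the Lefschetz group needs: polarised simple CM factors with commutative
## endomorphism algebras of full dimension -/

-- budget: destructuring the prequel's 13-clause model and choosing polarisations on the factors; headroom ×2
set_option maxHeartbeats 400000 in
/-- **The isogeny factors of an abelian variety of CM-type, as the Lefschetz group sees them**: `A ∼ ∏ⱼ Bⱼ^{mⱼ}`, `mⱼ ≥ 1`,
with `Bⱼ = ℂ^{Φⱼ}/u(𝔪ⱼ)` SIMPLE, pairwise non-isogenous, POLARISED (`ωⱼ`, rational Gram matrix `Gⱼ`), `End_ℚ(Bⱼ) ≅ Kⱼ`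
COMMUTATIVE of dimension `[Kⱼ:ℚ] = 2 dim Bⱼ` («`K` is a CM-field»), and `[C(End⁰A):ℚ] = Σⱼ [Kⱼ:ℚ]`.
[cite: Deligne1982HodgeCycles, I §5 Prop. 5.1, p. 53] [cite: Milne1999LefschetzClasses, §3 p. 661 («`K` is a CM-field, and `S(A)` is a torus»)]
[cite: Shimura1998, §5.1 Props. 3, 4, 6 (pp. 36–38)] [cite: LangeBirkenhake1992, §4.1 (`E(Λ,Λ) ⊆ ℤ`)] -/
theorem exists_simple_polarized_cm_factors_of_isTorusSubgroup_mumfordTateGroupC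
    [Literature.AlgebraicGeometry.Motives.HodgeTensorFacts.{0, 0}] [Nonempty ι]
    (hX : IsAbelianVariety P) (hT : IsTorusSubgroup (mumfordTateGroupC P)) :
    ∃ (s : Type) (_ : Fintype s) (K : s → Type) (_ : ∀ j, Field (K j)) (_ : ∀ j, NumberField (K j))
      (Φ : ∀ j, CMType (K j)) (m : s → ℕ) (ω : ∀ j, (((Φ j : CMType (K j)).1 → ℂ) [⋀^Fin 2]→L[ℝ] ℝ))
      (G' : ∀ j, Matrix (Fin (finrank ℚ (K j))) (Fin (finrank ℚ (K j))) ℚ),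
      (∀ j, IsSimple (periodEquiv (Φ j) (finBasis ℚ (K j)))) ∧
      (∀ j, IsRiemannForm (periodEquiv (Φ j) (finBasis ℚ (K j))) (ω j)) ∧
      (∀ j, (G' j).map (Rat.cast : ℚ → ℝ) = latticeGram (periodEquiv (Φ j) (finBasis ℚ (K j))) (ω j)) ∧
      (∀ j j', j ≠ j' → ¬ IsIsogenous (periodEquiv (Φ j) (finBasis ℚ (K j))) (periodEquiv (Φ j') (finBasis ℚ (K j')))) ∧
      (∀ j, 0 < m j) ∧
      IsIsogenous P (sigmaPiPeriod fun j ↦ powPeriod (periodEquiv (Φ j) (finBasis ℚ (K j))) (m j)) ∧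
      (∀ j, ∀ a ∈ endAlgRat (periodEquiv (Φ j) (finBasis ℚ (K j))),
        ∀ b ∈ endAlgRat (periodEquiv (Φ j) (finBasis ℚ (K j))), a * b = b * a) ∧
      (∀ j, finrank ℚ (endAlgRat (periodEquiv (Φ j) (finBasis ℚ (K j)))) = Fintype.card (Fin (finrank ℚ (K j)))) ∧
      finrank ℚ (Subalgebra.center ℚ (endAlgRat P)) = ∑ j, finrank ℚ (K j) := by
  obtain ⟨s, _, K, _, _, Φ, m, -, -, hsimple, hAV, hK, hne, hm, hiso, -, -, -, hZ, -⟩ :=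
    hX.exists_simple_cm_factors_of_isTorusSubgroup_mumfordTateGroupC hT
  -- polarisations with rational Gram matrices on the factors `Bⱼ`
  have hpol : ∀ j, ∃ (ω : ((Φ j : CMType (K j)).1 → ℂ) [⋀^Fin 2]→L[ℝ] ℝ)
      (G' : Matrix (Fin (finrank ℚ (K j))) (Fin (finrank ℚ (K j))) ℚ),
      IsRiemannForm (periodEquiv (Φ j) (finBasis ℚ (K j))) ω ∧
        G'.map (Rat.cast : ℚ → ℝ) = latticeGram (periodEquiv (Φ j) (finBasis ℚ (K j))) ω := fun j ↦ by
    obtain ⟨ω, hω⟩ := hAV j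
    obtain ⟨G', hG'⟩ := hω.exists_ratMatrix_latticeGram
    exact ⟨ω, G', hω, hG'⟩
  choose ω G' hω hG' using hpol
  -- `End_ℚ(Bⱼ) ≅ Kⱼ` is commutative of dimension `[Kⱼ:ℚ] = 2 dim Bⱼ`
  have hcomm : ∀ j, ∀ a ∈ endAlgRat (periodEquiv (Φ j) (finBasis ℚ (K j))),
      ∀ b ∈ endAlgRat (periodEquiv (Φ j) (finBasis ℚ (K j))), a * b = b * a := fun j a ha b hb ↦ by
    obtain ⟨e⟩ := hK j
    obtain ⟨x, hx⟩ := e.surjective ⟨a, ha⟩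
    obtain ⟨y, hy⟩ := e.surjective ⟨b, hb⟩
    have h1 : ((e x * e y : endAlgRat (periodEquiv (Φ j) (finBasis ℚ (K j)))) : Matrix _ _ ℚ) = a * b := by
      rw [hx, hy]; rfl
    have h2 : ((e y * e x : endAlgRat (periodEquiv (Φ j) (finBasis ℚ (K j)))) : Matrix _ _ ℚ) = b * a := by
      rw [hx, hy]; rfl
    rw [← h1, ← h2, ← map_mul, ← map_mul, mul_comm]
  have hdim : ∀ j, finrank ℚ (endAlgRat (periodEquiv (Φ j) (finBasis ℚ (K j)))) =
      Fintype.card (Fin (finrank ℚ (K j))) := fun j ↦ by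
    obtain ⟨e⟩ := hK j
    rw [Fintype.card_fin, ← e.toLinearEquiv.finrank_eq]
  exact ⟨s, inferInstance, K, inferInstance, inferInstance, Φ, m, ω, G', hsimple, hω, hG',
    fun j j' hjj hij ↦ hjj ((hne j j').1 hij), hm, hiso, hcomm, hdim, hZ⟩

/-! ## §1 «Connected: Yes» — `Lf(A)(ℂ) = S(A)(ℂ)` for every abelian variety whose Mumford–Tate group is a torus -/

/-- **MILNE'S TABLE, TYPE IV, «CONNECTED: YES», FOR EVERY ABELIAN VARIETY OF CM-TYPE: `Lf(A)(ℂ) = S(A)(ℂ)`** — for an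
abelian variety `A` of positive dimension whose Mumford–Tate group `MT(A)(ℂ)` is a torus and ANY polarisation `η`
(rational Gram matrix `G`), Milne's group `S(A)(ℂ)` (the centraliser of `End_ℚ(A)` in `Sp`) coincides with its identity
component, Lange's `Lf(A)(ℂ)`: `A ∼ ∏ⱼ Bⱼ^{mⱼ}` with simple CM factors of commutative `End_ℚ(Bⱼ) = Kⱼ` (Deligne Prop. 5.1 /
g28), and A4-92 («`S(A)_{/k^al} ≈ ∏ GL`», each factor a connected torus) with Prop. 1.5 along the isogeny.
[cite: Milne1999LefschetzClasses, §2 Summary table p. 652 (type IV: «Connected: Yes»), §3 p. 661 («`S(A)` is a torus»), Prop. 1.5]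
[cite: Deligne1982HodgeCycles, I §5 Prop. 5.1, p. 53] [cite: Lange2023AbelianVarietiesComplex, §7.2.4 Exercise (4)(c)] -/
theorem lefschetzIdentityC_eq_lefschetzGroupC_of_isTorusSubgroup_mumfordTateGroupC
    [Literature.AlgebraicGeometry.Motives.HodgeTensorFacts.{0, 0}] [Nonempty ι]
    (hX : IsAbelianVariety P) (hT : IsTorusSubgroup (mumfordTateGroupC P)) (hη : IsRiemannForm P η)
    (hG : G.map (Rat.cast : ℚ → ℝ) = latticeGram P η) :
    lefschetzIdentityC P G = lefschetzGroupC P G := by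
  obtain ⟨s, _, K, _, _, Φ, m, ω, G', hsimple, hω, hG', hni, hm, hiso, hcomm, hdim, -⟩ :=
    hX.exists_simple_polarized_cm_factors_of_isTorusSubgroup_mumfordTateGroupC hT
  exact hiso.lefschetzIdentityC_eq_lefschetzGroupC_of_powers_of_endAlgRat_comm hη hG hω hG'
    (homRat_eq_bot_of_isSimple_of_not_isIsogenous hsimple hni) hm hcomm hdim

/-- **Irreducibility form: the vanishing ideal of `S(A)(ℂ)` is prime** (`S(A)(ℂ)` is Zariski-irreducible), `A` of
CM-type, any polarisation. [cite: Milne1999LefschetzClasses, §2 Summary table p. 652 (type IV: «Connected: Yes»)]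
[cite: Deligne1982HodgeCycles, I §5 Prop. 5.1] -/
theorem isPrime_vanishingIdealC_lefschetzGroupC_of_isTorusSubgroup_mumfordTateGroupC
    [Literature.AlgebraicGeometry.Motives.HodgeTensorFacts.{0, 0}] [Nonempty ι]
    (hX : IsAbelianVariety P) (hT : IsTorusSubgroup (mumfordTateGroupC P)) (hη : IsRiemannForm P η)
    (hG : G.map (Rat.cast : ℚ → ℝ) = latticeGram P η) :
    (vanishingIdealC (lefschetzGroupC P G)).IsPrime := by
  rw [isPrime_vanishingIdealC_lefschetzGroupC_iff]
  exact hX.lefschetzIdentityC_eq_lefschetzGroupC_of_isTorusSubgroup_mumfordTateGroupC hT hη hG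

/-- **Real points: `Lf(A)(ℝ) = S(A)(ℝ)`** — Lange's `Lf(A)` is the whole real Lefschetz group `lefschetzGroup P η` of
`ComplexTorusLefschetzGroup.lean`, for `A` of CM-type and any polarisation `η`. [cite: Lange2023AbelianVarietiesComplex, §7.2.4 Exercise (4)]
[cite: Milne1999LefschetzClasses, §2 Summary table p. 652 (type IV: «Connected: Yes»)] -/
theorem lefschetzIdentity_eq_lefschetzGroup_of_isTorusSubgroup_mumfordTateGroupC
    [Literature.AlgebraicGeometry.Motives.HodgeTensorFacts.{0, 0}] [Nonempty ι]
    (hX : IsAbelianVariety P) (hT : IsTorusSubgroup (mumfordTateGroupC P)) (hη : IsRiemannForm P η)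
    (hG : G.map (Rat.cast : ℚ → ℝ) = latticeGram P η) :
    lefschetzIdentity P G = lefschetzGroup P η := by
  rw [← comap_lefschetzGroupC P hG, ← hX.lefschetzIdentityC_eq_lefschetzGroupC_of_isTorusSubgroup_mumfordTateGroupC hT hη hG]
  rfl

/-! ## §2 «`S(A)` is a torus» of dimension `rdim A = [C(End⁰A):ℚ]/2` -/

-- budget: one factor-wise instance dance (`IsReduced (End_ℚ Bⱼ)`) inside `choose`; headroom ×2
set_option maxHeartbeats 400000 in
/-- **«`K` is a CM-field, and `S(A)` is a torus» — FOR EVERY ABELIAN VARIETY OF CM-TYPE `S(A)(ℂ) ≅ (ℂ^×)^{rdim A}` with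
`2 rdim A = [C(End⁰A):ℚ]`.**  For `A` of positive dimension with `MT(A)(ℂ)` a torus and any polarisation (rational Gram
matrix `G`) there is a finite `R` with `2·#R = [C(End⁰A):ℚ]` and a group isomorphism `S(A)(ℂ) ≃* (R → ℂ^×)`:
Prop. 1.5 `S(A)(ℂ) ≅ ∏ⱼ S(Bⱼ)(ℂ)` along `A ∼ ∏ⱼ Bⱼ^{mⱼ}` (p36), the type-IV `d = 1` entry `S(Bⱼ)(ℂ) ≅ (ℂ^×)^{dim Bⱼ}`
for each simple CM factor (A4-92 §E «Dimension g, Rank g»), and `Σⱼ 2 dim Bⱼ = Σⱼ [Kⱼ:ℚ] = [C(End⁰A):ℚ]` (g28) — Gordon's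
`rdim A = Σᵢ rdim Aᵢ = Σᵢ (dim Aᵢ)/d` with `d = 1`. [cite: Milne1999LefschetzClasses, §3 p. 661; §2 pp. 651–652 («`S_σ ≈ GL_{g/(fd)}`», «`f` copies»); Prop. 1.5]
[cite: Gordon1999HodgeAVSurvey, 7.4 (`rdim`), 7.7] [cite: Deligne1982HodgeCycles, I §5 Prop. 5.1] -/
theorem exists_mulEquiv_lefschetzGroupC_pi_units_of_isTorusSubgroup_mumfordTateGroupC
    [Literature.AlgebraicGeometry.Motives.HodgeTensorFacts.{0, 0}] [Nonempty ι]
    (hX : IsAbelianVariety P) (hT : IsTorusSubgroup (mumfordTateGroupC P)) (hη : IsRiemannForm P η)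
    (hG : G.map (Rat.cast : ℚ → ℝ) = latticeGram P η) :
    ∃ (R : Type) (_ : Fintype R), 2 * Fintype.card R = finrank ℚ (Subalgebra.center ℚ (endAlgRat P)) ∧
      Nonempty (lefschetzGroupC P G ≃* (R → ℂˣ)) := by
  obtain ⟨s, _, K, _, _, Φ, m, ω, G', hsimple, hω, hG', hni, hm, hiso, hcomm, hdim, hZ⟩ :=
    hX.exists_simple_polarized_cm_factors_of_isTorusSubgroup_mumfordTateGroupC hT
  -- Prop. 1.5 on complex points: `S(A)(ℂ) ≃ ∏ⱼ S(Bⱼ)(ℂ)`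
  obtain ⟨e₁⟩ := hiso.nonempty_lefschetzGroupC_mulEquiv_pi_of_powers hη hG hω hG' hsimple hni hm
  -- each factor: `S(Bⱼ)(ℂ) ≃ (ℂ^×)^{[Kⱼ:ℚ]/2}`
  have hfac : ∀ j, ∃ R : Finset (Fin (finrank ℚ (K j))), Fintype.card (Fin (finrank ℚ (K j))) = 2 * R.card ∧
      Nonempty (lefschetzGroupC (periodEquiv (Φ j) (finBasis ℚ (K j))) (G' j) ≃* (↥R → ℂˣ)) := fun j ↦ by
    haveI := (hω j).isSemisimpleRing_endAlgRat
    letI : CommRing (endAlgRat (periodEquiv (Φ j) (finBasis ℚ (K j)))) :=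
      { (inferInstance : Ring (endAlgRat (periodEquiv (Φ j) (finBasis ℚ (K j))))) with
        mul_comm := fun a b ↦ Subtype.ext (hcomm j a.1 a.2 b.1 b.2) }
    haveI : IsReduced (endAlgRat (periodEquiv (Φ j) (finBasis ℚ (K j)))) := inferInstance
    obtain ⟨R, hR, hE⟩ := exists_mulEquiv_lefschetzGroupC_pi_units_of_endAlgRat_comm
      (periodEquiv (Φ j) (finBasis ℚ (K j))) (hcomm j) (hdim j) (transpose_eq_neg_of_map_ratCast _ (hG' j))
      (isUnit_det_of_map_ratCast (hG' j) (hω j).isUnit_det_latticeGram)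
      fun A hA ↦ rosati_mem_endAlgRat _ (hω j).1 (hω j).2.2 (hG' j) hA
    exact ⟨R, hR, hE⟩
  choose R hR hE using hfac
  -- assemble: `∏ⱼ (Rⱼ → ℂ^×) ≃ (Σⱼ Rⱼ) → ℂ^×`
  let e₂ : (∀ j, lefschetzGroupC (periodEquiv (Φ j) (finBasis ℚ (K j))) (G' j)) ≃* ∀ j, (↥(R j) → ℂˣ) :=
    MulEquiv.piCongrRight fun j ↦ (hE j).some
  let e₃ : (∀ j, (↥(R j) → ℂˣ)) ≃* ((Σ j, ↥(R j)) → ℂˣ) :=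
    MulEquiv.mk' (Equiv.piCurry (fun (j : s) (_ : ↥(R j)) ↦ ℂˣ)).symm fun _ _ ↦ rfl
  refine ⟨(Σ j, ↥(R j)), inferInstance, ?_, ⟨e₁.trans (e₂.trans e₃)⟩⟩
  rw [hZ, Fintype.card_sigma, Finset.mul_sum]
  exact Finset.sum_congr rfl fun j _ ↦ by rw [Fintype.card_coe, ← hR j, Fintype.card_fin]

/-- **`S(A)(ℂ)` is COMMUTATIVE for `A` of CM-type** (a torus; Milne's table, type IV: the only non-semisimple entry).
[cite: Milne1999LefschetzClasses, §3 p. 661 («`S(A)` is a torus»); §2 Summary table (type IV: «Semisimple: No»)] -/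
theorem lefschetzGroupC_comm_of_isTorusSubgroup_mumfordTateGroupC
    [Literature.AlgebraicGeometry.Motives.HodgeTensorFacts.{0, 0}] [Nonempty ι]
    (hX : IsAbelianVariety P) (hT : IsTorusSubgroup (mumfordTateGroupC P)) (hη : IsRiemannForm P η)
    (hG : G.map (Rat.cast : ℚ → ℝ) = latticeGram P η) :
    ∀ x ∈ lefschetzGroupC P G, ∀ y ∈ lefschetzGroupC P G, x * y = y * x := by
  obtain ⟨R, _, -, ⟨e⟩⟩ := hX.exists_mulEquiv_lefschetzGroupC_pi_units_of_isTorusSubgroup_mumfordTateGroupC hT hη hG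
  intro x hx y hy
  have h := e.injective (show e (⟨x, hx⟩ * ⟨y, hy⟩) = e (⟨y, hy⟩ * ⟨x, hx⟩) by rw [map_mul, map_mul, mul_comm])
  exact congrArg Subtype.val h

/-- **`rdim A ≤ dim A`**: the torus `S(A)(ℂ) ≅ (ℂ^×)^{#R}` has `2·#R = [C(End⁰A):ℚ] ≤ 2 dim A`.
[cite: Gordon1999HodgeAVSurvey, 7.4] [cite: Shimura1998, §5.1 Props. 1, 6 (pp. 36–38)] -/
theorem exists_mulEquiv_lefschetzGroupC_pi_units_card_le_of_isTorusSubgroup_mumfordTateGroupC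
    [Literature.AlgebraicGeometry.Motives.HodgeTensorFacts.{0, 0}] [Nonempty ι]
    (hX : IsAbelianVariety P) (hT : IsTorusSubgroup (mumfordTateGroupC P)) (hη : IsRiemannForm P η)
    (hG : G.map (Rat.cast : ℚ → ℝ) = latticeGram P η) :
    ∃ (R : Type) (_ : Fintype R), 2 * Fintype.card R ≤ Fintype.card ι ∧ Nonempty (lefschetzGroupC P G ≃* (R → ℂˣ)) := by
  obtain ⟨R, _, hR, hE⟩ := hX.exists_mulEquiv_lefschetzGroupC_pi_units_of_isTorusSubgroup_mumfordTateGroupC hT hη hG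
  exact ⟨R, inferInstance, hR ▸ hX.finrank_center_endAlgRat_le_card_of_isTorusSubgroup_mumfordTateGroupC hT, hE⟩

/-- **`A` SIMPLE of CM-type: `S(A)(ℂ) ≅ (ℂ^×)^{dim A}`** (type IV with `d = 1`, `f = g`: «Dimension g, Rank g» — the
type-IV `E = K` row of the table at variety level; `[C(End⁰A):ℚ] = [K:ℚ] = 2 dim A`).
[cite: Milne1999LefschetzClasses, §2 «Simple abelian variety of type IV» pp. 650–651 and Summary table p. 652; §3 p. 661] -/
theorem exists_mulEquiv_lefschetzGroupC_pi_units_of_isSimple_of_isTorusSubgroup_mumfordTateGroupC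
    [Literature.AlgebraicGeometry.Motives.HodgeTensorFacts.{0, 0}] [Nonempty ι] [FiniteDimensional ℂ E]
    (hX : IsAbelianVariety P) (hS : IsSimple P) (hT : IsTorusSubgroup (mumfordTateGroupC P)) (hη : IsRiemannForm P η)
    (hG : G.map (Rat.cast : ℚ → ℝ) = latticeGram P η) :
    ∃ (R : Type) (_ : Fintype R), Fintype.card R = finrank ℂ E ∧ Nonempty (lefschetzGroupC P G ≃* (R → ℂˣ)) := by
  obtain ⟨R, _, hR, hE⟩ := hX.exists_mulEquiv_lefschetzGroupC_pi_units_of_isTorusSubgroup_mumfordTateGroupC hT hη hG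
  rw [hX.finrank_center_endAlgRat_eq_card_of_isSimple_of_isTorusSubgroup_mumfordTateGroupC hS hT,
    card_eq_two_mul_finrank P] at hR
  exact ⟨R, inferInstance, by omega, hE⟩

/-! ## §3 `Hg` twins («`Hg(A)(ℂ)` is an algebraic torus», Gordon's Prop. 2.12 wording) -/

/-- §1 from «`Hg(A)(ℂ)` is a torus»: `Lf(A)(ℂ) = S(A)(ℂ)`. [cite: Gordon1997, §2 Prop. 2.12] [cite: Milne1999LefschetzClasses, §2 Summary table (type IV: «Connected: Yes»)] -/
theorem lefschetzIdentityC_eq_lefschetzGroupC_of_isTorusSubgroup_map_toGL_hodgeGroupC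
    [Literature.AlgebraicGeometry.Motives.HodgeTensorFacts.{0, 0}] [Nonempty ι]
    (hX : IsAbelianVariety P) (hT : IsTorusSubgroup ((hodgeGroupC P).map Matrix.SpecialLinearGroup.toGL))
    (hη : IsRiemannForm P η) (hG : G.map (Rat.cast : ℚ → ℝ) = latticeGram P η) :
    lefschetzIdentityC P G = lefschetzGroupC P G :=
  hX.lefschetzIdentityC_eq_lefschetzGroupC_of_isTorusSubgroup_mumfordTateGroupC
    ((isTorusSubgroup_mumfordTateGroupC_iff_map_toGL_hodgeGroupC P).2 hT) hη hG

/-- §1 real points from «`Hg(A)(ℂ)` is a torus»: `Lf(A)(ℝ) = S(A)(ℝ)`. [cite: Gordon1997, §2 Prop. 2.12] [cite: Lange2023AbelianVarietiesComplex, §7.2.4 Exercise (4)] -/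
theorem lefschetzIdentity_eq_lefschetzGroup_of_isTorusSubgroup_map_toGL_hodgeGroupC
    [Literature.AlgebraicGeometry.Motives.HodgeTensorFacts.{0, 0}] [Nonempty ι]
    (hX : IsAbelianVariety P) (hT : IsTorusSubgroup ((hodgeGroupC P).map Matrix.SpecialLinearGroup.toGL))
    (hη : IsRiemannForm P η) (hG : G.map (Rat.cast : ℚ → ℝ) = latticeGram P η) :
    lefschetzIdentity P G = lefschetzGroup P η :=
  hX.lefschetzIdentity_eq_lefschetzGroup_of_isTorusSubgroup_mumfordTateGroupC
    ((isTorusSubgroup_mumfordTateGroupC_iff_map_toGL_hodgeGroupC P).2 hT) hη hG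

/-- §2 from «`Hg(A)(ℂ)` is a torus»: `S(A)(ℂ) ≃* (R → ℂ^×)`, `2·#R = [C(End⁰A):ℚ]`. [cite: Gordon1997, §2 Prop. 2.12]
[cite: Milne1999LefschetzClasses, §3 p. 661 («`S(A)` is a torus»)] -/
theorem exists_mulEquiv_lefschetzGroupC_pi_units_of_isTorusSubgroup_map_toGL_hodgeGroupC
    [Literature.AlgebraicGeometry.Motives.HodgeTensorFacts.{0, 0}] [Nonempty ι]
    (hX : IsAbelianVariety P) (hT : IsTorusSubgroup ((hodgeGroupC P).map Matrix.SpecialLinearGroup.toGL))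
    (hη : IsRiemannForm P η) (hG : G.map (Rat.cast : ℚ → ℝ) = latticeGram P η) :
    ∃ (R : Type) (_ : Fintype R), 2 * Fintype.card R = finrank ℚ (Subalgebra.center ℚ (endAlgRat P)) ∧
      Nonempty (lefschetzGroupC P G ≃* (R → ℂˣ)) :=
  hX.exists_mulEquiv_lefschetzGroupC_pi_units_of_isTorusSubgroup_mumfordTateGroupC
    ((isTorusSubgroup_mumfordTateGroupC_iff_map_toGL_hodgeGroupC P).2 hT) hη hG

/-- §2 from «`Hg(A)(ℂ)` is a torus»: `S(A)(ℂ)` is commutative. [cite: Gordon1997, §2 Prop. 2.12] [cite: Milne1999LefschetzClasses, §3 p. 661] -/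
theorem lefschetzGroupC_comm_of_isTorusSubgroup_map_toGL_hodgeGroupC
    [Literature.AlgebraicGeometry.Motives.HodgeTensorFacts.{0, 0}] [Nonempty ι]
    (hX : IsAbelianVariety P) (hT : IsTorusSubgroup ((hodgeGroupC P).map Matrix.SpecialLinearGroup.toGL))
    (hη : IsRiemannForm P η) (hG : G.map (Rat.cast : ℚ → ℝ) = latticeGram P η) :
    ∀ x ∈ lefschetzGroupC P G, ∀ y ∈ lefschetzGroupC P G, x * y = y * x :=
  hX.lefschetzGroupC_comm_of_isTorusSubgroup_mumfordTateGroupC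
    ((isTorusSubgroup_mumfordTateGroupC_iff_map_toGL_hodgeGroupC P).2 hT) hη hG

end IsAbelianVariety

end Literature.Geometry.Kaehler.ComplexTorus
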